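import Summits.HubbardSuperconductivity.HubbardSuperconductivity.Theorems.NodalWardXYPerturbedXYOrderLinearResponse

/-!
# STRATEGY-CENSUS companion (crux stmt-HubbardSuperconductivity-10739 `NodalWardXY.PerturbedXYOrder`, crux-strategist p1)

Typed, farm-checked forms of the census attempts (`Cruxes/PerturbedXYOrder/STRATEGY-CENSUS.md`):

* `## Decomposition` D1 — the best typed split: `ZeroFreeXY3` (uniform-in-`L` zero-freeness, the
  Fisher-type core) and `PlateauInheritanceXY3` (tilted plateau bounded GIVEN zero-freeness on the doubled
  ray).  PROVED here: the split is EXACT, `PerturbedXYOrder ↔ ZeroFreeXY3 ∧ PlateauInheritanceXY3`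
  (`perturbedXYOrder_iff_split`), so the glue `perturbedXYOrder_of_split` is landable as it stands; the
  census explains why it is nevertheless NOT filed (piece 1 ⊇ the bond-diagonal Fisher problem, piece 2 is
  not soft: an analytic `g` with `0 ≤ g ≤ 1` on the real diameter and `|g| ≤ e^{CεL³}` on the disc can be
  `e^{CεL³}` at `t = i`).
* `## Strengthen` / milestone — `LinearResponseXY3` (M1, order-ε¹, REAL measure; necessary by
  `stub_linearResponseOfCrux`, p119633) and `FisherZeroFreeNN3` (X3, the bond-diagonal special case; necessary
  by `perturbedXYOrder_bondDiagonal`, p117339, restated here over the same vocabulary).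

Vocabulary: `Theorems/NodalWardXYDefs.lean` (`Bond`, `Admissible`, `Zk`, `cratio`).  No `sorry`.
-/

noncomputable section

set_option linter.dupNamespace false

namespace Summit.HubbardSuperconductivity.HubbardSuperconductivity.Cruxes.PerturbedXYOrder.StrategyCensus

open MeasureTheory Literature.Probability.LatticeModels
open Summit.HubbardSuperconductivity.HubbardSuperconductivity.Theses.NodalWardXY
open Summit.HubbardSuperconductivity.HubbardSuperconductivity.Theorems.PerturbedXYOrder

/-- **Sub₁ (D1): uniform zero-freeness** — no Fisher-type zero of the two-current tilt inside the admissible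
polydisc, uniformly in the torus: `∃ J₀ ε₁ > 0, ∀ J ≥ J₀, ∀ L ≥ 2, ∀ K ∈ Adm(ε₁), Z_K ≠ 0`.  Strictly weaker in
form than the crux (no plateau); contains the bond-diagonal statement `FisherZeroFreeNN3` below. -/
def ZeroFreeXY3 : Prop :=
  ∃ J₀ ε₁ : ℝ, 0 < ε₁ ∧ ∀ J : ℝ, J₀ ≤ J → ∀ (L : ℕ) [NeZero L], 2 ≤ L →
    ∀ K : Bond L → Bond L → ℂ, Admissible L ε₁ K → Zk J K ≠ 0

/-- **Sub₂ (D1): plateau inheritance** — for an admissible kernel whose doubled ray `t • K`, `‖t‖ ≤ 2`, is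
zero-free, the complex plateau `num_K/Z_K/L⁶` is bounded, uniformly in `L` ("state from pressure" for the one
non-local observable `|m|²`).  Per-`K` conditional, hence silent near zeros and NOT a rewording of `ZeroFreeXY3`. -/
def PlateauInheritanceXY3 : Prop :=
  ∃ J₀ ε B : ℝ, 0 < ε ∧ 0 < B ∧ ∀ J : ℝ, J₀ ≤ J → ∀ (L : ℕ) [NeZero L], 2 ≤ L →
    ∀ K : Bond L → Bond L → ℂ, Admissible L ε K →
      (∀ t : ℂ, ‖t‖ ≤ 2 → Zk J (t • K) ≠ 0) → ‖cratio L J K‖ ≤ B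

/-- **Milestone M1: linear response** (HANDBACK-c5 §0.2) — the order-`ε¹` Taylor coefficient of the tilted plateau,
i.e. `L⁻⁶ Cov_{J,L}(|M|², W_K)` of the REAL low-temperature rotator (p119738), is bounded uniformly in `L`. -/
def LinearResponseXY3 : Prop :=
  ∃ J₀ ε C : ℝ, 0 < ε ∧ ∀ J : ℝ, J₀ ≤ J → ∀ (L : ℕ) [NeZero L], 2 ≤ L →
    ∀ K : Bond L → Bond L → ℂ, Admissible L ε K → ‖deriv (fun t : ℂ => cratio L J (t • K)) 0‖ ≤ C

/-- **X3: the bond-diagonal Fisher-type special case** (HANDBACK-c4 §3) — uniform-in-`L` zero-freeness and plateau of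
the nearest-neighbour rotator with complex single-bond weight `exp(J cos x + z sin² x)`, `‖z‖ ≤ ε`. -/
def FisherZeroFreeNN3 : Prop :=
  ∃ J₀ ε a : ℝ, 0 < ε ∧ 0 < a ∧ ∀ J : ℝ, J₀ ≤ J → ∀ (L : ℕ) [NeZero L], 2 ≤ L →
    ∀ z : ℂ, ‖z‖ ≤ ε → Zk J (fun b b' : Bond L => if b = b' then z else 0) ≠ 0 ∧
      a ≤ (cratio L J (fun b b' : Bond L => if b = b' then z else 0)).re

/-- Admissibility is monotone in the radius (restated; `lv_admissible_mono` lives in a sibling module). -/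
theorem admissible_mono {L : ℕ} [NeZero L] {ε ε' : ℝ} (h : ε ≤ ε') {K : Bond L → Bond L → ℂ}
    (hK : Admissible L ε K) : Admissible L ε' K := fun b b' =>
  (hK b b').trans (div_le_div_of_nonneg_right h (by positivity))

/-- **Glue of the split D1** (landable as `…_of_subs`): zero-freeness at radius `ε₁` and plateau inheritance at
radius `ε` give complex stability at radius `min (ε₁/2) ε` (the doubled ray of such a kernel stays in `Adm(ε₁)`,
`equiv_admissible_ray`), hence the crux by `perturbedXYOrder_of_complexStability` (p86213). -/
theorem perturbedXYOrder_of_split (hZ : ZeroFreeXY3) (hP : PlateauInheritanceXY3) : PerturbedXYOrder := by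
  obtain ⟨J₀, ε₁, hε₁, hZ⟩ := hZ
  obtain ⟨J₁, ε, B, hε, hB, hP⟩ := hP
  apply perturbedXYOrder_of_complexStability
  refine ⟨max J₀ J₁, min (ε₁ / 2) ε, B, by positivity, hB, ?_⟩
  intro J hJ L _ hL K hK
  have hK₁ : Admissible L (ε₁ / 2) K := admissible_mono (min_le_left _ _) hK
  have hKε : Admissible L ε K := admissible_mono (min_le_right _ _) hK
  have hray : ∀ t : ℂ, ‖t‖ ≤ 2 → Zk J (t • K) ≠ 0 := fun t ht =>
    hZ J (le_trans (le_max_left _ _) hJ) L hL _ (equiv_admissible_ray hε₁.le hK₁ ht)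
  refine ⟨?_, hP J (le_trans (le_max_right _ _) hJ) L hL K hKε hray⟩
  have h1 := hray 1 (by norm_num)
  rwa [one_smul] at h1

/-- Sub₁ is necessary (crux ⇒ complex stability, p106199). -/
theorem zeroFree_of_perturbedXYOrder (h : PerturbedXYOrder) : ZeroFreeXY3 := by
  obtain ⟨J₀, ε₂, B, hε₂, -, hCS⟩ := complexStability_of_perturbedXYOrder h
  exact ⟨J₀, ε₂, hε₂, fun J hJ L _ hL K hK => (hCS J hJ L hL K hK).1⟩

/-- Sub₂ is necessary (its hypothesis is not even used: crux ⇒ bounded plateau outright). -/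
theorem plateauInheritance_of_perturbedXYOrder (h : PerturbedXYOrder) : PlateauInheritanceXY3 := by
  obtain ⟨J₀, ε₂, B, hε₂, hB, hCS⟩ := complexStability_of_perturbedXYOrder h
  exact ⟨J₀, ε₂, B, hε₂, hB, fun J hJ L _ hL K hK _ => (hCS J hJ L hL K hK).2⟩

/-- **The split is exact.** `PerturbedXYOrder ↔ ZeroFreeXY3 ∧ PlateauInheritanceXY3`. -/
theorem perturbedXYOrder_iff_split : PerturbedXYOrder ↔ ZeroFreeXY3 ∧ PlateauInheritanceXY3 :=
  ⟨fun h => ⟨zeroFree_of_perturbedXYOrder h, plateauInheritance_of_perturbedXYOrder h⟩,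
    fun h => perturbedXYOrder_of_split h.1 h.2⟩

/-- M1 is necessary (p119633, restated in the census vocabulary). -/
theorem linearResponse_of_perturbedXYOrder (h : PerturbedXYOrder) : LinearResponseXY3 :=
  stub_linearResponseOfCrux h

/-- Sub₁ already contains the zero half of X3: `ZeroFreeXY3 →` no zero on the complex bond-diagonal. -/
theorem fisherZeroFree_of_zeroFree (h : ZeroFreeXY3) :
    ∃ J₀ ε : ℝ, 0 < ε ∧ ∀ J : ℝ, J₀ ≤ J → ∀ (L : ℕ) [NeZero L], 2 ≤ L →
      ∀ z : ℂ, ‖z‖ ≤ ε → Zk J (fun b b' : Bond L => if b = b' then z else 0) ≠ 0 := by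
  obtain ⟨J₀, ε, hε, hZ⟩ := h
  refine ⟨J₀, ε, hε, fun J hJ L _ hL z hz => hZ J hJ L hL _ ?_⟩
  intro b b'
  by_cases hb : b = b'
  · subst hb
    simp only [if_true, SimpleGraph.dist_self, Nat.cast_zero, add_zero, one_pow, div_one]
    exact hz
  · simp only [if_neg hb, norm_zero]
    positivity

end Summit.HubbardSuperconductivity.HubbardSuperconductivity.Cruxes.PerturbedXYOrder.StrategyCensus

end
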